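import Summits.BirchSwinnertonDyer.Rank1Residual.Ordinary.Conjectures.KolyvaginKimDatumOfEulerSystemReduction
import Summits.BirchSwinnertonDyer.Rank1Residual.Ordinary.Conjectures.KolyvaginKimDatumOfEulerSystemAnyPrime
import Summits.BirchSwinnertonDyer.Rank1Residual.Ordinary.StrictSelmerIndexFormalLevel
import Literature.NumberTheory.EllipticCurves.LocalPointsPlaceTransportProofs
import HarnessLib

/-!
# LAW-2 at `p = 3` from an Euler system of `T_3E` with THEOREM D's place-`3` certificate `htop` and reduction tower DISCHARGED
# (companion of `KolyvaginKimDatumOfEulerSystemAnyPrime.lean` (F32) and `KolyvaginKimDatumOfEulerSystemReduction.lean` (F34);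
# theorems only; nothing asserted; the depth law stays a CONJECTURE of the cell)

HONEST FRAMING (cell `b2b-bsdres`, run/shared/lean/b2b/bsd-rank1-residual/, verbatim in every
file): the goal of the cell is to DELETE the COMBINATION-SHAPED residual classes of the
Birch–Swinnerton-Dyer formula for ALL analytic-rank `≤ 1` elliptic curves over `ℚ` — "full BSD
formula for every rank `≤ 1` curve in class `C`" assembled STRICTLY from published theorems — so
that the rank-`≤ 1` remainder becomes exactly the CONSTRUCTION-SHAPED classes, which are TYPED
(missing-input `Prop`s), NOT attempted. This is not "finishing BSD". Seat `b2b-bsdres-additive-p3`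
(X8 prover B / X7 joint; typer-designate for the cell conjecture C-16 = hyp C120.1; ladder BSD:K3 hand-off to cell
`bsd-ssimc`; written inside the D-0075 claim window). This file books nothing and moves no mark; X7 / X8 stay
CONSTRUCTION-SHAPED; C-16 and the depth law (`R1-DEPTH-LAW.md` §1, LAW-2) = CONJECTURES. NO Euler system is asserted (binder `hc`).

## What this file does

F32 §2 `zmodPowOrd_kuriharaNumber_eq_of_isEulerSystem_torsionCoeff` derives LAW-2 at `(ℓ, k₀)` —
`ord_p(δ̃_ℓ mod p^{k₀}) = min(k₀, F + 2·v_ℓ(P))`, any formal level `m = m_p(P)` in the derived regime — for ANY odd good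
non-anomalous `p` from an Euler system of `T_pE`, with n1011's generic THEOREM D (D6) binders displayed; among them the place-`p`
certificate `htop : 𝓕_can,p(E[p^k·p]) = ⊤`, an artefact of THEOREM D's technique rather than a property of the curve visible in print.
At `p = 3` that certificate FOLLOWS from the letter data F32 already displays (`3 ∤ Δ_min`, `3 ∤ #Ẽ(𝔽₃)`):

* §1 `forall_nsmul_eq_zero_adicCompletion_of_not_dvd_reductionPointCount` — for ANY odd good non-anomalous `p`, `E(ℚ_v)[p] = 0` at
  the place `v ∋ p` in the `adicCompletion` currency of THEOREM D's binders: the chain's `ℚ_[p]`-lemma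
  `forall_nsmul_eq_zero_padic_of_not_dvd_reductionPointCount` (`Ordinary/StrictSelmerIndexFormalLevel.lean`, AEC IV.6.1 + VII.2.1)
  read through the tree's `WeierstrassCurve.forall_nsmul_eq_zero_adicCompletion_iff_padic` (`E(ℚ_v) ≃+ E(ℚ_p)`). (The generic form
  of F31b's `forall_three_nsmul_eq_zero_adicCompletion_of_frobeniusTrace_three`; consumable by any `…_of_torsion_eq_zero` END.)
* §2 `propagatedSelmerStructure_three_eq_top_of_not_dvd_reductionPointCount` — at `p = 3`: `𝓕_can,3(E[3^k·3]) = ⊤` at the place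
  over `3` for every `k`, from `3 ∤ Δ_min`, `3 ∤ #Ẽ(𝔽₃)` (§1 + n1011 F11/F12 `propagatedSelmerStructure_three_eq_top_of_torsion_eq_zero`
  along F34's reduction tower `exists_torsionReductionTower W 3`).
* §3 `zmodPowOrd_kuriharaNumber_eq_of_isEulerSystem_torsionCoeff_three_canonicalRed` — F32 §2 AT `p = 3` with `htop` DISCHARGED
  (§2): LAW-2 at `3` (any `m₃(P)`, derived regime) from Poitou–Tate, the local Euler characteristic at `vℓ`/`v₃`, the letter data,
  an Euler system of `T_3E` (binder), THE CANONICAL datum, THEOREM D's ONLY remaining curve-level certificate `hbad`, Sakamoto's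
  `(Sτ, τ)`, the divisibility witness and the two readings. A generic-`p` discharge of `htop` needs Mazur–Rubin Lemma A.1 at every
  level for general `p` (n1011's F12 is on file at `p = 3` only) — not attempted here.

Nothing here is new mathematics (§1 = two tree lemmas composed; §2 = F12 ∘ §1 ∘ F34; §3 = F32 §2 applied). LAW-2 stays a CONJECTURE.

References: B. Mazur, K. Rubin, Mem. AMS 799 (2004) Thm. 3.2.4, 5.2.12, App. A (Lemma A.1) [MazurRubin2004]; C.-H. Kim,
arXiv:2203.12159 Thm. 3.13, (5.3) [Kim2022StructureSelmer]; R. Sakamoto, JTNB 36 (2024) §2, Def. 4.1 [Sakamoto2024]; J. S. Milne,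
ADT (2006) I 2.8, 4.10(b) [MilneADT2006]; J. H. Silverman, AEC (2009) IV.6.1, VII.2.1 [SilvermanAEC2009].
-/

noncomputable section

open CategoryTheory Function Finset Field IsDedekindDomain
open scoped NumberField Classical ContRepresentation MatrixGroups
open CongruenceSubgroup WeierstrassCurve Literature.NumberTheory.EllipticCurves
  Literature.NumberTheory.EllipticCurves.ModularForms
  Literature.NumberTheory.EllipticCurves.Rank1Residual
  Literature.NumberTheory.GaloisRepresentations Literature.NumberTheory.GaloisCohomology
  Literature.NumberTheory.GaloisRepresentations.DiscreteGaloisModule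
  NumberField
  Summit.BirchSwinnertonDyer.Rank1Residual.GaloisImage
  Summit.BirchSwinnertonDyer.Rank1Residual.GaloisImage.CoeffTransport
  Summit.BirchSwinnertonDyer.Rank1Residual.GaloisImage.CyclotomicLevel
  Summit.BirchSwinnertonDyer.Rank1Residual.GaloisImage.TorsionCoeff
  Rat.HeightOneSpectrum

namespace Summit.BirchSwinnertonDyer.Rank1Residual.Ordinary

variable (W : WeierstrassCurve ℚ) [W.IsElliptic] [W.IsGloballyMinimal]

/-! ### §1 `E(ℚ_v)[p] = 0` at `v ∋ p` for an odd good non-anomalous `p`, in the `adicCompletion` currency -/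

section TorsionAtP

variable {p : ℕ} [hp : Fact p.Prime]

omit [W.IsElliptic] in
/-- **`E(ℚ_v)[p] = 0` at the place `v ∋ p` for an odd good non-anomalous prime `p`** (`p ∤ Δ_min`, `p ∤ #Ẽ(𝔽_p)`), in the
`adicCompletion` currency of THEOREM D's place-`p` certificates: the chain's `forall_nsmul_eq_zero_padic_of_not_dvd_reductionPointCount`
(AEC IV.6.1: no `p`-torsion in `E₁(ℚ_p)` for odd `p`; VII.2.1: reduction is injective on prime-to-kernel torsion) read through
`WeierstrassCurve.forall_nsmul_eq_zero_adicCompletion_iff_padic`. [cite: SilvermanAEC2009, IV.6.1 and Prop. VII.2.1] -/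
theorem forall_nsmul_eq_zero_adicCompletion_of_not_dvd_reductionPointCount (hp2 : p ≠ 2)
    (hgood : ¬ (p : ℤ) ∣ minimalDiscriminantInt W) (hna : ¬ p ∣ W.reductionPointCount p)
    (v : HeightOneSpectrum (𝓞 ℚ)) (hv : ((p : ℕ) : 𝓞 ℚ) ∈ v.asIdeal)
    (P : (W.baseChange (v.adicCompletion ℚ)).toAffine.Point) (hP : p • P = 0) : P = 0 :=
  (W.forall_nsmul_eq_zero_adicCompletion_iff_padic hv p).mpr
    (forall_nsmul_eq_zero_padic_of_not_dvd_reductionPointCount W hp2 hgood hna) P hP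

end TorsionAtP

/-! ### §2 `p = 3`: `𝓕_can,3 = ⊤` at every level from `3 ∤ Δ_min`, `3 ∤ #Ẽ(𝔽₃)` -/

section TopAtThree

variable [Module.Free ℤ_[3] (W.tateModule 3)] [Module.Finite ℤ_[3] (W.tateModule 3)]
  [ContinuousSMul ℤ_[3] (W.tateModule 3)]

omit [Module.Free ℤ_[3] (W.tateModule 3)] [Module.Finite ℤ_[3] (W.tateModule 3)]
  [ContinuousSMul ℤ_[3] (W.tateModule 3)] in
/-- **`𝓕_can,3(E[3^k·3])_w = ⊤` at the place `w` over `3`, every `k`, when `3 ∤ Δ_min` and `3 ∤ #Ẽ(𝔽₃)`** — THEOREM D's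
place-`3` certificate `htop` DISCHARGED from the letter data: §1 at `p = 3` gives `E(ℚ_w)[3] = 0`, n1011's F11/F12
`propagatedSelmerStructure_three_eq_top_of_torsion_eq_zero` (Mazur–Rubin Lemma A.1 along the reduction tower) gives `⊤`, the tower
being F34's `exists_torsionReductionTower W 3`. [cite: MazurRubin2004, App. A, Lemma A.1 (p. 79)]
[cite: SilvermanAEC2009, IV.6.1 and Prop. VII.2.1] -/
theorem propagatedSelmerStructure_three_eq_top_of_not_dvd_reductionPointCount
    (hgoodp : ¬ ((3 : ℕ) : ℤ) ∣ minimalDiscriminantInt W) (hna : ¬ 3 ∣ W.reductionPointCount 3) (k : ℕ)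
    (w : HeightOneSpectrum (𝓞 ℚ)) (hw3 : ((primesEquiv w : Nat.Primes) : ℕ) = 3) :
    haveI : Fact (Nat.Prime 3) := ⟨Nat.prime_three⟩
    propagatedSelmerStructure W 3 k (Sum.inr w) = ⊤ := by
  haveI : Fact (Nat.Prime 3) := ⟨Nat.prime_three⟩
  obtain ⟨rd, hrd⟩ := exists_torsionReductionTower W 3
  have hv : ((3 : ℕ) : 𝓞 ℚ) ∈ w.asIdeal :=
    (natCast_mem_asIdeal_iff_eq_primesEquiv_symm w Nat.prime_three).mpr
      (primesEquiv.injective (by rw [Equiv.apply_symm_apply]; exact Subtype.ext hw3))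
  exact propagatedSelmerStructure_three_eq_top_of_torsion_eq_zero W w hv
    (forall_nsmul_eq_zero_adicCompletion_of_not_dvd_reductionPointCount W (p := 3) (by decide) hgoodp hna w hv) rd hrd k

end TopAtThree

/-! ### §3 LAW-2 at `p = 3` from an Euler system of `T_3E`, `htop` and the reduction tower discharged -/

section LawAtThree

variable [Module.Free ℤ_[3] (W.tateModule 3)] [Module.Finite ℤ_[3] (W.tateModule 3)]
  [ContinuousSMul ℤ_[3] (W.tateModule 3)]

/-- Local notation: `T∞ = T_3 E` as a continuous `G_ℚ`-representation (as in n1011's THEOREM D files). -/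
local notation3 "T∞" => WeierstrassCurve.tateGaloisRep W 3 (W.continuous_galoisRepTate_holds 3)

variable (S : Set (HeightOneSpectrum (𝓞 ℚ)))

/-- Local notation: `𝓛` = the cyclotomic Euler-system levels `ℚ(μ_{3^{n+1}}, μ_r)`, `r ∩ S = ∅`. -/
local notation3 "𝓛" => cyclotomicLevelsRat 3 S

/-- Local notation: `𝐃ℤ⟦X, U, τ⟧ ℓ = ∑_{j < ℓ−1} j·(τ_ℓ)_*^j` on `H¹(U, X)` (`ℤ`-linear), Kolyvagin's derivative operator. -/
local notation3 (prettyPrint := false) "𝐃ℤ⟦" X ", " U ", " τ "⟧" =>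
  fun ℓ : HeightOneSpectrum (𝓞 ℚ) =>
  ∑ j ∈ Finset.range (((primesEquiv ℓ : Nat.Primes) : ℕ) - 1),
    (j : Module.End ℤ (continuousCohomology 1 (subgroupRep X U))) *
      (conjMap X U ((τ : HeightOneSpectrum (𝓞 ℚ) → absoluteGaloisGroup ℚ) ℓ) 1).hom.toLinearMap ^ j

/-- Local notation: the level-`j` reduction `red_j : T_3E ⟶ E[3^j]_{ℤ_3}` (n1011 GZ-2). -/
local notation3 "𝐫𝐞𝐝⟦" j "⟧" => tateModuleRed W 3 (W.continuous_galoisRepTate_holds 3) j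

variable {N : ℕ} (f : CuspForm (Gamma0 N) 2) (ℓ k₀ k : ℕ) [Fact ℓ.Prime] (P : W.toAffine.Point) (F m : ℕ)
  (vℓ vp : HeightOneSpectrum (𝓞 ℚ)) (ψ : (q : ℕ) → (ZMod q)ˣ →* Multiplicative (ZMod (3 ^ k₀)))

/-- **LAW-2 at `(ℓ, k₀)`, `p = 3`, from an EULER SYSTEM of `T_3E` — F32 §2 `zmodPowOrd_kuriharaNumber_eq_of_isEulerSystem_torsionCoeff`
at `p = 3` with THEOREM D's place-`3` certificate `htop` DISCHARGED from the letter data (`3 ∤ Δ_min`, `3 ∤ #Ẽ(𝔽₃)`; §2) and its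
reduction tower supplied (F34).** `ord₃(δ̃_ℓ mod 3^{k₀}) = min(k₀, F + 2·v_ℓ(P))` for any formal level `m = m₃(P)` in the derived regime,
from Poitou–Tate over `ℚ`, the local Euler characteristic at `vℓ` and `vp`, the letter data (`hgoodp`, `hna`, `hm1`/`hm2`, `ℓ` cyclic with
`ℓ ∈ 𝒫_{k+1}`, `k₀ ≤ k+1`, `3 ∤ u`, `hreg`), an Euler system `c` of `T_3E` over the cyclotomic levels (Kato's — a binder, NOT asserted),
`Irr(E[3])`, THE CANONICAL datum `D ∋ vℓ`, THEOREM D's ONLY remaining curve-level certificate `hbad` (`E(ℚ_w)[3] = 0` at the bad `w ≠ 3`),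
Sakamoto's `(Sτ, τ)`, the divisibility witness, and the reading hypothesis on every derived system (bottom class `κ((3^{m+F}·u)·P)`, MR
Thm. 5.2.12; Kim's reading of `κ_{vℓ}` at `vp`, Thm. 3.13 + (5.3), OPEN at `3`). LAW-2 stays a CONJECTURE of the cell (nothing here
asserts its inputs). [cite: MazurRubin2004, Thm. 3.2.4, Thm. 5.2.12 and App. A] [cite: Kim2022StructureSelmer, Thm. 3.13 and (5.3)]
[cite: MilneADT2006, Ch. I, Thm. 4.10(b) and Thm. 2.8] [cite: Sakamoto2024, §2 (p. 921) and Def. 4.1 (p. 926)]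
[cite: SilvermanAEC2009, IV.6.1 and Prop. VII.2.1] -/
theorem zmodPowOrd_kuriharaNumber_eq_of_isEulerSystem_torsionCoeff_three_canonicalRed
    (hgoodp : ¬ ((3 : ℕ) : ℤ) ∣ minimalDiscriminantInt W) (hna : ¬ 3 ∣ W.reductionPointCount 3)
    (hm1 : W.reductionPointCount 3 • Affine.Point.map (W' := W.toAffine) (Algebra.ofId ℚ ℚ_[3]) P ∈
      (W.baseChange ℚ_[3]).formalFiltration (m + 1))
    (hm2 : W.reductionPointCount 3 • Affine.Point.map (W' := W.toAffine) (Algebra.ofId ℚ ℚ_[3]) P ∉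
      (W.baseChange ℚ_[3]).formalFiltration (m + 2))
    (hcycℓ : IsCyclicKolyvaginLevel W 3 ℓ)
    (hvℓ : (ℓ : 𝓞 ℚ) ∈ vℓ.asIdeal) (hvp : ((3 : ℕ) : 𝓞 ℚ) ∈ vp.asIdeal)
    (hPT : poitouTate_sum_localTatePairing_eq_zero ℚ)
    (hEPℓ : localEulerPoincareCharacteristic (vℓ.adicCompletion ℚ))
    (hEPp : localEulerPoincareCharacteristic (vp.adicCompletion ℚ))
    (hk : k₀ ≤ k + 1) (hKP : Kato.IsKolyvaginPrime W 3 (k + 1) ℓ) {u : ℕ} (hu : ¬ 3 ∣ u)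
    (hreg : m = 0 ∨ m + F + 2 * localDivExponent W 3 ℓ P < k + 1)
    -- the Euler system and THEOREM D's binders
    {c : ∀ (i : ℕ) (r : (𝓛).Ideals), H1 T∞ ((𝓛).level i r.1)}
    (hc : IsEulerSystem 𝓛 T∞ 3 c) (hirr : W.HasIrreducibleModPGaloisRep 3)
    (D : KolyvaginDatum (W.torsionGaloisModule (((3 : ℕ) : ℤ) ^ k * ((3 : ℕ) : ℤ))))
    (hT : D.transverse = cyclotomicTransverse (W.torsionGaloisModule (((3 : ℕ) : ℤ) ^ k * ((3 : ℕ) : ℤ))))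
    {η : (q : HeightOneSpectrum (𝓞 ℚ)) → (ZMod (Ideal.absNorm q.asIdeal))ˣ}
    (hD : D.HasCanonicalComparison (3 ^ (k + 1)) η)
    (hPr : D.primes ⊆ (𝓛).primes)
    (hKol : ∀ q ∈ D.primes, Kato.IsKolyvaginPrime W 3 (k + 1) ((primesEquiv q : Nat.Primes) : ℕ))
    -- THEOREM D's ONLY remaining curve-level certificate at `p = 3` (`htop` is DISCHARGED below from `hgoodp`/`hna`)
    (hbad : ∀ w : HeightOneSpectrum (𝓞 ℚ), ¬ W.HasGoodReductionAt w →
      ((primesEquiv w : Nat.Primes) : ℕ) ≠ 3 →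
        ∀ P : (W.baseChange (w.adicCompletion ℚ)).toAffine.Point, 3 • P = 0 → P = 0)
    -- Sakamoto's `τ`-class for the canonical datum, `vℓ ∈ 𝒫`, the divisibility witness
    (Sτ : Set (HeightOneSpectrum (𝓞 ℚ))) {τ : absoluteGaloisGroup ℚ}
    (hτq : Nonempty (cokerSubOne (W.torsionGaloisModule (((3 : ℕ) : ℤ) ^ k * ((3 : ℕ) : ℤ))) τ ≃+ ZMod (3 ^ (k + 1))))
    (hτμ : τ ∈ rootsOfUnityFixer ℚ (3 ^ (k + 1)))
    (hP : D.primes ⊆ frobeniusClassPrimes (W.torsionGaloisModule (((3 : ℕ) : ℤ) ^ k * ((3 : ℕ) : ℤ))) Sτ τ (3 ^ (k + 1)))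
    (hDℓ : vℓ ∈ D.primes)
    (hdiv : ∀ X : geomPoints W, ∃ R : geomPoints W, (((3 : ℕ) : ℤ) ^ k * ((3 : ℕ) : ℤ)) • R = X)
    -- the two READINGS of the derived system, for `Q = (3^{m+F}·u)·P`
    (hread : letI := TorsionCoeff.torsionBy.padicIntModule 3 (k + 1) (WeierstrassCurve.geomPoints W)
      ∀ (σ : HeightOneSpectrum (𝓞 ℚ) → absoluteGaloisGroup ℚ)
        (Φ : ∀ r : Finset (HeightOneSpectrum (𝓞 ℚ)),
          continuousCohomology 1 (subgroupRep (torsionRepPadicInt W 3 (k + 1)).toTopRep ((𝓛).level ⊥ r)) →+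
            continuousCohomology 1 (subgroupRep
              (W.torsionGaloisModule (((3 : ℕ) : ℤ) ^ k * ((3 : ℕ) : ℤ))).toTopRep ((𝓛).level ⊥ r)))
        (comm : ∀ r : Finset (HeightOneSpectrum (𝓞 ℚ)),
          ((r : Finset _) : Set (HeightOneSpectrum (𝓞 ℚ))).Pairwise fun a b =>
            Commute (𝐃ℤ⟦(W.torsionGaloisModule (((3 : ℕ) : ℤ) ^ k * ((3 : ℕ) : ℤ))).toTopRep, ((𝓛).level ⊥ r), σ⟧ a)
              (𝐃ℤ⟦(W.torsionGaloisModule (((3 : ℕ) : ℤ) ^ k * ((3 : ℕ) : ℤ))).toTopRep, ((𝓛).level ⊥ r), σ⟧ b))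
        (κ : Finset (HeightOneSpectrum (𝓞 ℚ)) →
          galoisCohomology (W.torsionGaloisModule (((3 : ℕ) : ℤ) ^ k * ((3 : ℕ) : ℤ))) 1),
        (∀ q, σ q ∈ (adicCompletionPrime ℚ q).inertia (absoluteGaloisGroup ℚ)) →
        (∀ q, modNCyclotomicCharacter ℚ (Ideal.absNorm q.asIdeal) (σ q) = η q) →
        (∀ r, ∀ (φ : contOneCocycles (subgroupRep (torsionRepPadicInt W 3 (k + 1)).toTopRep ((𝓛).level ⊥ r)))
          (ψ' : contOneCocycles (subgroupRep
            (W.torsionGaloisModule (((3 : ℕ) : ℤ) ^ k * ((3 : ℕ) : ℤ))).toTopRep ((𝓛).level ⊥ r))),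
          (∀ g, ψ'.1 g = AddSubgroup.inclusion (geomTorsion_pow_succ_eq W 3 k).le (φ.1 g)) →
            Φ r (oneCocycleClass _ φ) = oneCocycleClass _ ψ') →
        D.IsKolyvaginSystem (propagatedSelmerStructure W 3 k) κ →
        (∀ r : Finset (HeightOneSpectrum (𝓞 ℚ)), ¬ (↑r : Set _) ⊆ D.primes → κ r = 0) →
        (∀ (r : Finset (HeightOneSpectrum (𝓞 ℚ))) (hr : (↑r : Set _) ⊆ D.primes),
          resSubgroup (W.torsionGaloisModule (((3 : ℕ) : ℤ) ^ k * ((3 : ℕ) : ℤ))).toTopRep ((𝓛).level ⊥ r) 1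
              (κ r) =
            (r.noncommProd 𝐃ℤ⟦(W.torsionGaloisModule (((3 : ℕ) : ℤ) ^ k * ((3 : ℕ) : ℤ))).toTopRep,
                ((𝓛).level ⊥ r), σ⟧ (comm r))
              (Φ r (ContinuousCohomology.map (ContinuousMonoidHom.id _)
                (X := subgroupRep T∞.toTopRep ((𝓛).level ⊥ r))
                (Y := subgroupRep (torsionRepPadicInt W 3 (k + 1)).toTopRep ((𝓛).level ⊥ r))
                ((TopRep.resFunctor ((𝓛).level ⊥ r).subtype).map 𝐫𝐞𝐝⟦k + 1⟧) 1
                (c ⊥ ⟨r, fun _ hq => hPr (hr (Finset.mem_coe.2 hq))⟩)))) →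
        κ ∅ = kummerMapTorsion W (((3 : ℕ) : ℤ) ^ k * ((3 : ℕ) : ℤ)) hdiv ((3 ^ (m + F) * u) • P) ∧
        ∀ ψp : galoisCohomology ((W.torsionGaloisModule (((3 : ℕ) : ℤ) ^ k * ((3 : ℕ) : ℤ))).toLocal (Sum.inr vp)) 1 ⧸
            W.kummerSelmerStructure (((3 : ℕ) : ℤ) ^ k * ((3 : ℕ) : ℤ)) (Sum.inr vp) ≃+ ZMod (3 ^ (k + 1)),
          (haveI : NeZero ℓ := ⟨(Fact.out : ℓ.Prime).ne_zero⟩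
           zmodPowOrd 3 k₀ (kuriharaNumber f (3 ^ k₀) ℓ ψ)) =
            min k₀ (zmodPowOrd 3 (k + 1)
              (ψp (galoisCohomology.localization (W.torsionGaloisModule (((3 : ℕ) : ℤ) ^ k * ((3 : ℕ) : ℤ)))
                (Sum.inr vp) 1 (κ {vℓ}))))) :
    (haveI : NeZero ℓ := ⟨(Fact.out : ℓ.Prime).ne_zero⟩
     zmodPowOrd 3 k₀ (kuriharaNumber f (3 ^ k₀) ℓ ψ)) = min k₀ (F + 2 * localDivExponent W 3 ℓ P) := by
  have htop : ∀ w : HeightOneSpectrum (𝓞 ℚ), ((primesEquiv w : Nat.Primes) : ℕ) = 3 →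
      propagatedSelmerStructure W 3 k (Sum.inr w) = ⊤ := fun w hw3 =>
    propagatedSelmerStructure_three_eq_top_of_not_dvd_reductionPointCount W hgoodp hna k w hw3
  exact zmodPowOrd_kuriharaNumber_eq_of_isEulerSystem_torsionCoeff W 3 S f ℓ k₀ k P F m vℓ vp ψ (by decide) hgoodp hna
    hm1 hm2 hcycℓ hvℓ hvp hPT hEPℓ hEPp hk hKP hu hreg hc hirr D hT hD hPr hKol hbad htop Sτ hτq hτμ hP hDℓ hdiv hread

end LawAtThree

end Summit.BirchSwinnertonDyer.Rank1Residual.Ordinary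

end
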